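import Mathlib
import Summits.Ventures.HodgeRepro.CMType
import Summits.Ventures.HodgeRepro.HodgeSets
import Summits.Ventures.HodgeRepro.CMRank
import Summits.Ventures.HodgeRepro.MuTable

/-!
# The μ-table in Deligne's coordinates (blind cell `pub-hodge-repro`, seat p2)

Deligne (LNM 900, Ex. 3.7) writes the Hodge cocharacter of a CM type `Φ` as
`μ = Σ_{s ∈ Φ} e_s + e_0 ∈ Y(E^×) × Y(𝔾_m) = ℤ^S × ℤ` and the cocharacter group of the Mumford–Tate
torus as the Galois module generated by `μ`, i.e. the span of the conjugates `gμ = Σ_{s ∈ gΦ} e_s + e_0`.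
The typer's `typeMatrix Φ` / `cmRank Φ` drop the `e_0`-coordinate.  This file shows that the
`e_0`-coordinate changes nothing: the rank of the *augmented* table (rows `gμ = (ind (gΦ), 1)`) is
`cmRank Φ`.  Reason: the all-ones functional `Σ_s` takes the value `|Φ|` on every row `ind (gΦ)`, so
the augmented rows are the image of the rows of `typeMatrix Φ` under the injective linear map
`v ↦ (v, (Σ_s v s)/|Φ|)`.
-/

open Finset
open scoped Pointwise

namespace HodgeRepro

variable {G : Type*} [Group G] [DecidableEq G] [Fintype G]

/-- The μ-table in Deligne's coordinates: row `g` is `gμ = Σ_{s ∈ gΦ} e_s + e_0`, i.e. `(ind (gΦ), 1)`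
in `ℚ^G × ℚ` (LNM 900, Ex. 3.7, `Y(E^×) × Y(𝔾_m) = ℤ^S × ℤ`). -/
def augTable (Φ : Finset G) : Matrix G (G ⊕ Unit) ℚ :=
  Matrix.of fun g => Sum.elim (ind (g • Φ)) fun _ => 1

omit [Fintype G] in
/-- The `G`-block of the augmented table is `typeMatrix Φ`. -/
theorem augTable_apply_inl (Φ : Finset G) (g s : G) : augTable Φ g (Sum.inl s) = typeMatrix Φ g s :=
  rfl

omit [Fintype G] in
/-- The last column of the augmented table is the constant `1`. -/
theorem augTable_apply_inr (Φ : Finset G) (g : G) (u : Unit) : augTable Φ g (Sum.inr u) = 1 :=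
  rfl

/-- The linear map `v ↦ (v, (Σ_s v s)/|Φ|)` sending the row `ind (gΦ)` of `typeMatrix Φ` to the row
`(ind (gΦ), 1)` of `augTable Φ`. -/
def augMap (Φ : Finset G) : (G → ℚ) →ₗ[ℚ] (G ⊕ Unit → ℚ) where
  toFun v := Sum.elim v fun _ => (∑ s, v s) / Φ.card
  map_add' v w := by
    ext x
    rcases x with s | u
    · simp
    · simp [Finset.sum_add_distrib, add_div]
  map_smul' a v := by
    ext x
    rcases x with s | u
    · simp
    · simp only [Pi.smul_apply, smul_eq_mul, RingHom.id_apply, Sum.elim_inr, ← Finset.mul_sum,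
        mul_div_assoc]

omit [Group G] [DecidableEq G] in
/-- `augMap` unfolds to `v ↦ (v, (Σ_s v s)/|Φ|)`. -/
theorem augMap_apply (Φ : Finset G) (v : G → ℚ) :
    augMap Φ v = Sum.elim v fun _ => (∑ s, v s) / Φ.card := rfl

omit [Group G] [DecidableEq G] in
/-- `augMap Φ` is injective (its first block is the identity). -/
theorem augMap_injective (Φ : Finset G) : Function.Injective (augMap Φ) := by
  intro v w h
  ext s
  have := congrFun h (Sum.inl s)
  simpa [augMap_apply] using this

/-- The augmented row `gμ` is the image of the row `ind (gΦ)` (for a nonempty CM type). -/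
theorem augTable_row_eq (Φ : Finset G) (hΦ : Φ.card ≠ 0) (g : G) :
    augTable Φ g = augMap Φ (typeMatrix Φ g) := by
  ext x
  rcases x with s | u
  · rfl
  · simp only [augTable_apply_inr, augMap_apply, Sum.elim_inr, typeMatrix_row, sum_ind,
      card_smul_finset]
    exact (div_self (by exact_mod_cast hΦ)).symm

/-- The Galois conjugates `gμ` in Deligne's coordinates span a space of dimension `cmRank Φ`: the
`e_0`-coordinate adds nothing to the rank (Deligne Ex. 3.7 vs Gordon §9.1 / Dodson §1.1). -/
theorem rank_augTable (Φ : Finset G) (hΦ : Φ.card ≠ 0) : (augTable Φ).rank = cmRank Φ := by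
  unfold cmRank
  rw [Matrix.rank_eq_finrank_span_row, Matrix.rank_eq_finrank_span_row]
  have hrange : Set.range (augTable Φ).row = augMap Φ '' Set.range (typeMatrix Φ).row := by
    ext v
    simp only [Set.mem_range, Set.mem_image, exists_exists_eq_and]
    constructor
    · rintro ⟨g, rfl⟩
      exact ⟨g, (augTable_row_eq Φ hΦ g).symm⟩
    · rintro ⟨g, rfl⟩
      exact ⟨g, augTable_row_eq Φ hΦ g⟩
  rw [hrange, Submodule.span_image]
  exact ((Submodule.equivMapOfInjective (augMap Φ) (augMap_injective Φ) _).finrank_eq).symm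

/-- Deligne's form of the rank statement for a CM type: the augmented table has rank `cmRank Φ`. -/
theorem rank_augTable_of_isCMType {c : G} {Φ : Finset G} (hc : IsComplexConj c) (hΦ : IsCMType c Φ) :
    (augTable Φ).rank = cmRank Φ :=
  rank_augTable Φ (by
    have := hΦ.two_mul_card hc
    have := Fintype.card_pos (α := G)
    omega)

end HodgeRepro
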